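import Summits.BirchSwinnertonDyer.BirchSwinnertonDyer.Theorems.SignedBaseChangeAnticyclotomicEisensteinDivisibilitySpecializationRat
import Summits.BirchSwinnertonDyer.BirchSwinnertonDyer.Theorems.ErratumRoadFiveTwoVariableCharIdealDescent
import HarnessLib

/-!
# Crux 4 `BSDpOnCellC` (stmt-BirchSwinnertonDyer-19034), line «crystal» v10, stub `stub_acDescent`: the ALGEBRA of the descent
# `T₁ ↦ 0` through a control map with FINITE-EXPONENT COKERNEL (cell `bsd-eis`, width seat `bsd-line-x2-p2` gen 14;
# `--supports stmt-BirchSwinnertonDyer-19034`; skeleton of record UNCHANGED, W-79)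

`S2Coker.map_toUnr₂_map_constantCoeff_le_rat_of_coker` — bsd-wall's rational specialisation
`S2.map_toUnr₂_map_constantCoeff_le_rat` (crux -20727, sbc-p1; Herbrand `ch_A(N/XN) = ch_A(N[X])·π(ch_{A⟦X⟧}N)` =
`PowerSeriesSpecialization.charIdeal_quotSMulTop_eq_mul`) with the SURJECTIVE control map replaced by a `Λ`-linear control map
`f : X/T₁X → Y` into a finitely generated `Y` whose COKERNEL HAS FINITE EXPONENT (`p^a · Y ⊆ f(X/T₁X)`): for `X` f.g. over
`Λ₂ = ℤ_p⟦T₂⟧⟦T₁⟧` killed by some `s` with `s(0) ≠ 0` and `p^m · X[T₁] = 0`, `∃ k, p^k · π(ch_{Λ₂}X · Λ^ur) ⊆ ch_Λ(Y) · 𝒪⟦T⟧` —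
multiplicativity twice (`Module.charIdeal_eq_mul_of_exact`): `p^{n₁} π(ch X) ⊆ ch(X/T₁X) = ch(ker f)·ch(f(X/T₁X)) ⊆ ch(f(X/T₁X))` and
`ch(Y) = ch(f(X/T₁X))·ch(Y/f) ∋ … · p^{n₂}` (`Module.exists_pow_mem_charIdeal_of_pow_smul_eq_zero`). This is the shape in which crux 4's
control `X_Gr(E_K/K̃_∞)/T₁ → X_ac^∅(E_K)` is available when `E(K)[p] ≠ 0` (cokernel = dual of
`ker(Sel_𝔭̄(K_∞^{ac}) → Sel(K̃_∞)) ⊆ H¹(Gal(K̃_∞/K_∞^{ac}), E(K̃_∞)[p^∞])`). Consumed by `…AcDescentOfInputs`.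

HONEST FRAMING: pure commutative algebra over abstract modules; one theorem, 0 defs, 0 named facts, 0 sorry; nothing about elliptic curves is
asserted; no summit statement / BSD / MC / IMC is proved; 0 cells / labels / tiers move.

References: [Ochiai2006] Def. 7.1, Lemma 7.2 (Compositio 142 pp. 1187–1188); [SkinnerUrban2014] Cor. 3.2.9 (ii) (p. 24);
[JetchevSkinnerWan2017] Cor. 3.4.2 (arXiv:1512.06894 p. 14); Bourbaki AC VII §4.5; tree: bsd-wall sbc-p1's
`SignedBaseChangeAnticyclotomicEisensteinDivisibilitySpecialization{Herbrand,Rat}`, bsd-stepL's `ErratumRoadFiveTwoVariableCharIdealDescent`.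
-/

set_option autoImplicit false
set_option linter.dupNamespace false

noncomputable section

open Function
open scoped Classical Pointwise

/-! ## §1 Algebra: rational specialisation `T₁ ↦ 0` through a control map with finite-exponent cokernel -/

namespace Summit.BirchSwinnertonDyer.BirchSwinnertonDyer.Theorems.SignedBaseChangeAcDivSpecialization

namespace S2Coker

open Literature.NumberTheory.EllipticCurves Literature.NumberTheory.EllipticCurves.Module LocalLength
  PowerSeriesSpecialization
  Summit.BirchSwinnertonDyer.BirchSwinnertonDyer.Theorems.ErratumThm23TwoVariable.TwoVariableDescent

/-- **Rational specialisation `T₁ ↦ 0` for `Λ₂ = ℤ_p⟦T₂⟧⟦T₁⟧ → Λ₁ = ℤ_p⟦T₂⟧`-modules through a control map with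
finite-exponent cokernel.** Let `X` be a finitely generated `Λ₂`-module killed by some `s` with `s(0) ≠ 0`, suppose `p^m`
kills `X[T₁]`, let `Y` be a finitely generated `Λ₁`-module and `f : X/T₁X → Y` a `Λ₁`-linear map (constants `Λ₁`-structure on
`X/T₁X`) with `p^a · Y ⊆ range f`. Then for every structure map `J : ℤ_p → 𝒪 = 𝒪_{ℂ_p}` there is `k` with
`C(p^k)·y ∈ ch_{Λ₁}(Y)·𝒪⟦T⟧` for every `y ∈ π(ch_{Λ₂}(X)·Λ^ur)`:
`p^{n₁}·π(ch X) ⊆ ch(X[T₁])·π(ch X) = ch(X/T₁X) = ch(ker f)·ch(range f) ⊆ ch(range f)` and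
`ch(Y) = ch(range f)·ch(Y/range f) ⊇ ch(range f)·p^{n₂}`. The surjective case `a = 0` is bsd-wall's
`S2.map_toUnr₂_map_constantCoeff_le_rat`. [cite: SkinnerUrban2014, Cor. 3.2.9 (ii) (p. 24)] [cite: Ochiai2006, Lemma 7.2] -/
theorem map_toUnr₂_map_constantCoeff_le_rat_of_coker (p : ℕ) [Fact p.Prime] (X : Type*) [AddCommGroup X]
    [Module (PowerSeries (IwasawaAlgebra p)) X] [Module.Finite (PowerSeries (IwasawaAlgebra p)) X]
    (Y : Type*) [AddCommGroup Y] [Module (IwasawaAlgebra p) Y] [Module.Finite (IwasawaAlgebra p) Y]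
    (hs : ∃ s : PowerSeries (IwasawaAlgebra p),
      PowerSeries.constantCoeff s ≠ 0 ∧ ∀ x : X, s • x = 0)
    (hm : ∃ m : ℕ, ∀ x : X, (PowerSeries.X : PowerSeries (IwasawaAlgebra p)) • x = 0 →
      ((p : PowerSeries (IwasawaAlgebra p)) ^ m) • x = 0)
    (f : letI : Module (IwasawaAlgebra p)
              (QuotSMulTop (PowerSeries.X : PowerSeries (IwasawaAlgebra p)) X) :=
            Module.compHom _ (PowerSeries.C (R := IwasawaAlgebra p))
      QuotSMulTop (PowerSeries.X : PowerSeries (IwasawaAlgebra p)) X →ₗ[IwasawaAlgebra p] Y)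
    (hf : ∃ a : ℕ, ∀ y : Y, ∃ q, ((p : IwasawaAlgebra p) ^ a) • y = f q)
    (J : ℤ_[p] →+* PadicComplexInt p) :
    ∃ k : ℕ, ∀ y ∈ ((charIdeal (PowerSeries (IwasawaAlgebra p)) X).map (IwasawaAlgebra₂.toUnr₂ p J)).map
        (PowerSeries.constantCoeff (R := PowerSeries (PadicComplexInt p))),
      PowerSeries.C (((p : ℕ) : PadicComplexInt p) ^ k) * y ∈
        (charIdeal (IwasawaAlgebra p) Y).map (PowerSeries.map J) := by
  haveI : UniqueFactorizationMonoid (PowerSeries (IwasawaAlgebra p)) :=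
    Literature.NumberTheory.IwasawaTheory.uniqueFactorizationMonoid_iwasawaAlgebraTwoVar p
  -- the constants algebra `C : Λ₁ → Λ₂` (NOT Mathlib's default `algebraPowerSeries`, `T ↦ T₁`)
  let alg : Algebra (IwasawaAlgebra p) (PowerSeries (IwasawaAlgebra p)) :=
    @MvPowerSeries.instAlgebra Unit (IwasawaAlgebra p) (IwasawaAlgebra p) _ _ (Algebra.id _)
  letI : Module (IwasawaAlgebra p) X := Module.compHom X (PowerSeries.C (R := IwasawaAlgebra p))
  have hIST : @IsScalarTower (IwasawaAlgebra p) (PowerSeries (IwasawaAlgebra p)) X alg.toSMul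
      inferInstance inferInstance :=
    @IsScalarTower.mk _ _ _ alg.toSMul _ _ fun a r m => by
      rw [@Algebra.smul_def _ _ _ _ alg a r, mul_smul]
      rfl
  -- the hypothesis on `X[T₁]` in `Λ₁`-form
  have hm' : ∃ m : ℕ, ∀ x : X, (PowerSeries.X : PowerSeries (IwasawaAlgebra p)) • x = 0 →
      ((p : IwasawaAlgebra p) ^ m) • x = 0 := by
    obtain ⟨m, hm⟩ := hm
    refine ⟨m, fun x hx => ?_⟩
    show (PowerSeries.C (R := IwasawaAlgebra p) ((p : IwasawaAlgebra p) ^ m)) • x = 0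
    rw [map_pow, map_natCast]
    exact hm x hx
  -- `(p^n₁) · π(ch X) ⊆ ch(X/T₁X)`
  obtain ⟨n₁, hn₁⟩ := @exists_span_pow_mul_map_charIdeal_le (IwasawaAlgebra p) _ _ _ _ _ X _ _ _ _ hIST hs
    _ IwasawaAlgebra.prime_natCast hm'
  obtain ⟨s, hs0, hs⟩ := hs
  haveI hQfin : Module.Finite (IwasawaAlgebra p)
      (QuotSMulTop (PowerSeries.X : PowerSeries (IwasawaAlgebra p)) X) :=
    @moduleFinite_quotSMulTop (IwasawaAlgebra p) _ X _ _ _ hIST _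
  have h1 := (@isTorsionBy_constantCoeff (IwasawaAlgebra p) _ X _ _ _ hIST s hs).1
  have htorsQ : Module.IsTorsion (IwasawaAlgebra p)
      (QuotSMulTop (PowerSeries.X : PowerSeries (IwasawaAlgebra p)) X) := fun q =>
    ⟨⟨PowerSeries.constantCoeff s, mem_nonZeroDivisors_of_ne_zero hs0⟩, @h1 q⟩
  -- `ch(X/T₁X) = ch(ker f) · ch(range f) ⊆ ch(range f)`
  set Rf : Submodule (IwasawaAlgebra p) Y := LinearMap.range f with hRf
  have hQ : charIdeal (IwasawaAlgebra p) (QuotSMulTop (PowerSeries.X : PowerSeries (IwasawaAlgebra p)) X) ≤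
      charIdeal (IwasawaAlgebra p) Rf := by
    rw [charIdeal_eq_mul_of_exact htorsQ (LinearMap.ker f.rangeRestrict).subtype f.rangeRestrict
      (Submodule.subtype_injective _) (LinearMap.surjective_rangeRestrict f)
      (LinearMap.exact_subtype_ker_map _)]
    exact Ideal.mul_le_left
  -- the cokernel `Y ⧸ range f` is killed by `p^a`; `Y` is torsion; `p^{n₂} ∈ ch(Y ⧸ range f)`
  obtain ⟨a, ha⟩ := hf
  have hC : ∀ c : Y ⧸ Rf, ((p : IwasawaAlgebra p) ^ a) • c = 0 := by
    intro c
    obtain ⟨y, rfl⟩ := Submodule.mkQ_surjective Rf c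
    obtain ⟨q, hq⟩ := ha y
    rw [← map_smul, Submodule.mkQ_apply, hq, Submodule.Quotient.mk_eq_zero]
    exact LinearMap.mem_range_self f q
  have htorsRf : Module.IsTorsion (IwasawaAlgebra p) Rf := fun r => by
    obtain ⟨q, hq⟩ := (LinearMap.mem_range.mp r.2)
    obtain ⟨t, ht⟩ := @htorsQ q
    refine ⟨t, Subtype.ext ?_⟩
    rw [Submonoid.smul_def, Submodule.coe_smul, ← hq, ← map_smul, Submodule.coe_zero]
    rw [Submonoid.smul_def] at ht
    rw [ht, map_zero]
  have hpa0 : ((p : IwasawaAlgebra p) ^ a) ≠ 0 := pow_ne_zero a IwasawaAlgebra.prime_natCast.ne_zero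
  have htorsC : Module.IsTorsion (IwasawaAlgebra p) (Y ⧸ Rf) := fun c =>
    ⟨⟨(p : IwasawaAlgebra p) ^ a, mem_nonZeroDivisors_of_ne_zero hpa0⟩, hC c⟩
  have htorsY : Module.IsTorsion (IwasawaAlgebra p) Y := by
    refine isTorsion_of_isTorsion_ker_of_surjective Rf.mkQ ?_ htorsC
    rw [Submodule.ker_mkQ]
    exact htorsRf
  obtain ⟨n₂, hn₂⟩ := exists_pow_mem_charIdeal_of_pow_smul_eq_zero (M := Y ⧸ Rf)
    IwasawaAlgebra.prime_natCast ⟨a, hC⟩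
  have hYmul : charIdeal (IwasawaAlgebra p) Y =
      charIdeal (IwasawaAlgebra p) Rf * charIdeal (IwasawaAlgebra p) (Y ⧸ Rf) :=
    charIdeal_eq_mul_of_exact htorsY Rf.subtype Rf.mkQ (Submodule.subtype_injective _)
      (Submodule.mkQ_surjective _) (LinearMap.exact_subtype_mkQ Rf)
  -- `Λ₁`-level: `(p^(n₂+n₁)) · π(ch X) ⊆ ch(Y)`
  have hY : Ideal.span {(p : IwasawaAlgebra p) ^ (n₂ + n₁)} *
      (charIdeal (PowerSeries (IwasawaAlgebra p)) X).map (PowerSeries.constantCoeff (R := IwasawaAlgebra p)) ≤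
      charIdeal (IwasawaAlgebra p) Y := by
    rw [pow_add, ← Ideal.span_singleton_mul_span_singleton, mul_assoc]
    refine (Ideal.mul_mono_right hn₁).trans ?_
    refine (Ideal.mul_mono_right hQ).trans ?_
    rw [hYmul, mul_comm]
    exact Ideal.mul_mono_right ((Ideal.span_singleton_le_iff_mem _).mpr hn₂)
  -- extend scalars along `J` and read membership-wise
  refine ⟨n₂ + n₁, fun y hy => ?_⟩
  rw [Ideal.map_map, S2.constantCoeff_comp_toUnr₂, ← Ideal.map_map] at hy
  have hY' := Ideal.map_mono (f := PowerSeries.map J) hY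
  rw [Ideal.map_mul, Ideal.map_span, Set.image_singleton, map_pow, map_natCast] at hY'
  refine hY' (Ideal.mul_mem_mul ?_ hy)
  rw [map_pow, map_natCast]
  exact Ideal.mem_span_singleton_self _

end S2Coker

end Summit.BirchSwinnertonDyer.BirchSwinnertonDyer.Theorems.SignedBaseChangeAcDivSpecialization


end
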